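import Literature.MathematicalPhysics.QuantumFieldTheory.Balaban1983to89.B9Thm31SiteGsqBlockDistReg335Y
import Literature.MathematicalPhysics.QuantumFieldTheory.Balaban1983to89.B9Thm37TransposedCommutator

/-!
# `Balaban1983to89.B9Thm31SiteGsqRecordCutoffReg335Y` — T. Bałaban, *Propagators for lattice gauge theories in a background field*, Commun. Math. Phys.
# **99** (1985) 389–434 [Balaban1985BackgroundPropagators] (3.88)–(3.89) p. 409 ∕ Cor 3.6 p. 408 ∕ (3.46) p. 398, with [B6] = [Balaban1984PropagatorsII] p. 247:
# ★★★ **THE FACTORS OF THE RANDOM WALK (3.88) IN `L²` FOR THE GENUINE LOCAL CUBE INVERSES `G′_□(U)` — THE FIRST FACTOR `M_hG′_□M_h`, THE PLAIN (MIDDLE)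
# FACTOR `K(h)G′_□M_h`, AND ALL FACTORS AT THE PARTITION OF RECORD `h_□ = hTY i q`**, files 22–24's cut-off hypotheses `|h| ≤ 1`, `|∂h| ≤ κ`, `|∂∂h| ≤ κ₂`,
# block oscillation `≤ κ_b` DISCHARGED there with [B6] p. 247's sizes `κ_j = C1F∕(8∕5·S_j)`, `κ₂_j = C2F∕(8∕5·S_j)²`, `κ_b = sLipT∕(L·M_h)` (`S_j = M_h·L^{j+1}`;
# lit-balaban `…CubeCoverCommutatorSizes(Grad)`, `…TransposedCommutator`, `B6Partition118KLevelTorusBinders`) (file 25 of width seat `pub-ymgap-dag-n06-w1`'s set)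

statement-level skeleton of published theorems with citation tags; proofs where landed; nothing here is a claim about the Yang–Mills mass gap

THE PRINT (verbatim).  p. 409, (3.88): *«G′ = Σ_□ h_□G′_□h_□ + G′ Σ_□ K(h_□)G′_□h_□»*, *«… |(K(h_□)G′_□h_□λ)(x)| ≤ O(M⁻¹)e^{−δ₀(Lʲη)⁻¹|y−y′|}|λ| (3.89)»*;
[B6] p. 247: *«|∂h_□| ≤ O(1)(MLʲη)⁻¹ … |Δh_□| ≤ O(1)(MLʲη)⁻² … h_□′(x′) − h_□′(x) can be estimated by O(1)M⁻¹d(y,y′)»*; p. 408, Cor 3.6 («constants independent of □»).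

WHY THIS FILE (cell `pub-ymgap`, node N06 [B9], width seat `pub-ymgap-dag-n06-w1`, gen 3).  Files 22–24 bound the walk's LAST factors `∇_νM_hG′_□M_h∇*_μ` and
`K(h)G′_□M_h∇*_μ` (source `∇*_μλ`) in `L²` for an ARBITRARY real cut-off `h` under four displayed size hypotheses.  The resummation of (3.88),
`G′ = (Σ_□ h_□G′_□h_□)·Σ_m (Σ_□ K(h_□)G′_□h_□)^m`, also has the FIRST factor `h_□G′_□h_□` and iterates the PLAIN factor `K(h_□)G′_□h_□` on arbitrary `L²` data: §W feeds
(3.46a) (file 20) and (3.46b) (file 21) for `G′_□` into file 23's `HS` size of `K(h)` (`hs_KhY_apply_le`), general weight and block to block (file 24's instantiation at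
dag-n06-w7's `ρ⁺_s`).  The walk uses ONE family of cut-offs, the partition of record `h_□ = hTY i q` (`q ∈ cubes 𝔅`, [B6] (2.36)): §R discharges the four hypotheses
there — `|h_□| ≤ 1` (`B6Partition118KLevelTorus.abs_hT_le_one`), `|∂h_□| ≤ κ_j` (lit-balaban `…CubeCoverCommutatorSizes.abs_hTY_shiftY_sub_le`), the per-direction
second difference `≤ κ₂_j` (lit-balaban `B9Thm37TransposedCommutator.abs_hTY_second_diff_le`, reordered — imported, not restated), the in-block oscillation `≤ κ_b`
(`…Binders.abs_hT_sub_le_distT` at distance 0) — and restates every factor with these sizes substituted.  Level bookkeeping for the reader (`…SizesGrad.C1F_div_bigSide_eq`,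
`C2F_div_bigSide_sq_eq`): `κ_j = (5∕8)C1F∕(L·M_h)·L^{−j}`, `κ₂_j = (5∕8)²C2F∕(L·M_h)²·L^{−2j}`; against the level factors of blocks `t, s` with `|j_t − j|, |j_s − j| ≤ 1` every
product is `O(M_h⁻¹)` — print's `θ_M = O(M⁻¹)`, uniformly in □ (that arithmetic is the consumer's, not asserted here).

WHAT IS PROVED (sorry-free; 0 `def`).  On the class `(bg9K (M_N ℂ) G i).Reg335 c α₀`, `G ≤ U(N)`, `N ≥ 1`, `0 ≤ c·M·α₀`, `c·M·α₀·(d+1) ≤ 1∕16`, EVERY site set `D`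
(`G′ = GsqY i (parSymY i) D U`), `δ₀ = 1∕(4(d+2))`, `‖λ‖²₁ = trIP 1 Λ Λ`, sources `Λ` on one block `s` for the block-to-block forms:
* §R1 `abs_hTY_le_one`, `abs_hTY_second_diff_le'` (per direction, reordered), `abs_hTY_sub_le_of_blkOf_eq` — the sizes at `hTY` in files 22–23's hypothesis shapes.
* §W1 `cutMulY_apply_eq_zero_of_apply_eq_zero`; ★★★ `hs_restrict_KhY_GsqY_cutMulY_le` — THE PLAIN `K(h)`-FACTOR, general weight `ω` (files 6∕8's hypotheses), source on
  `B` (`ω = 1`, levels `≤ j_B`), block-saturated output set `A` (levels in `[j′_A, j_A]`, `ω ≥ W` on `A` and on its backward neighbours):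
  `Σ_{z∈A} HS((K(h)G′M_hΛ)(z)) ≤ [1280(d+1)(d+2)κ²L^{2j_B} + (1024(d+1)²κ₂² + 512κ_b²L^{−4j′_A})L^{2j_A}L^{2j_B}]∕W²·‖λ‖²₁`.
* §W0 `hs_cutMulY_apply_le`; ★★ `hs_restrict_cutMulY_GsqY_cutMulY_le_distT` — THE FIRST FACTOR `M_hG′M_h`, block `s` → blocks at distance `≥ n`: `256·L^{2j_A}L^{2j_s}·e^{−2δ₀(n−1)∕(2L)}`.
* §W2 ★★★ `hs_block_KhY_GsqY_cutMulY_le_distT` — the plain factor block `s` → block `t`, `d_T(t,s) ≥ n`, rate `e^{−2δ₀((n−2)∕(2L) − 1)}`, `j_A = j′_A = lev t`, `j_B = lev s + 1`.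
* §R2 at `h = hTY i q`, every cube `q`, no cut-off hypothesis left: ★★ `hs_restrict_cdS_hTY_GsqY_hTY_cdsS_le_distT` (`∇_νh_□G′h_□∇*_μ`), ★★★ `hs_block_KhTY_GsqY_hTY_cdsS_le_distT`
  (`K(h_□)G′h_□∇*_μ`), ★★★ `hs_block_KhTY_GsqY_hTY_le_distT` (`K(h_□)G′h_□`), ★★ `hs_restrict_hTY_GsqY_hTY_le_distT` (`h_□G′h_□`).
MODEL ∕ SCOPE as files 19–24 (def-Y's carrier `SiteY i`, `𝔸 = M_N(ℂ)`, HS currency per site; cut-offs BY NAME `B9Thm37CubeCoverCommutators.hTY`).  NOT HERE: `D = □̃(q)`, the overlap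
count and convergence of the resummation (dag-n06-k ∕ lit-balaban `…CubeCoverResummation`), the coordinate∕block-`L²` reading (dag-n06-d FILE C, dag-n06-w7), the sup-norm (3.89)
(lit-balaban M5.4-est).  NON-VACUITY (A6): as file 20.  HONEST SCOPE: compositions of landed `L²` estimates + instantiation bookkeeping; NOT a node discharge, NOT summit progress;
count-neutral; nothing continuum ∕ OS ∕ mass gap ∕ Clay; the YM mass gap (Clay) is NOT proved by any of this — R4 closes the conditional finite-𝕋⁴ rung `BalabanLadder.UV` only.
NEW file importing file 24 and `B9Thm37TransposedCommutator` only.  Net new unproved facts: 0.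
-/

noncomputable section

namespace Literature.MathematicalPhysics.QuantumFieldTheory.Balaban1983to89.B9Thm31SiteGsqRecordCutoffReg335Y

open Literature.MathematicalPhysics.QuantumFieldTheory.Balaban1983to89
open Node00 B6KLevelCensusIndexV1 B6Geom246MultiLevelBox B6MultiLevelBoxOperator B6MultiLevelTorusOperator B6GlobalChartV1 B9BackgroundsKLevelV1
  B9Eq39Adjoint B9Thm311ReadingCoords B9Thm311DeltaPrimePos B9Ineq369CurvatureSmallAtLettersY B9Thm31SiteCoerciveGaugeBlockY B9Thm31SiteCoerciveReg335Y
  B9Thm31SiteGpBoundsReg335Y B9Thm31SitePolarisedFormY B9Thm31SiteConjugatedFormY B9Thm31SiteGpDecayReg335Y B9Thm31SiteAgmonWeightY B9Thm31SiteAgmonExponentY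
  B9Thm31SiteGpGradDecayReg335Y B9Thm31SiteGpDivDecayReg335Y B9Thm31SiteGradGpDivDecayReg335Y Node00.OpsYLocalInverse B9Thm311LocalInversePosY
  B9Thm31SiteGsqBoundsReg335Y B9Thm31SiteGsqDecayReg335Y B9Thm31SiteGsqGradDecayReg335Y B9Thm31SiteGsqCutoffMixedReg335Y B9Thm31SiteGsqCutoffFactorsReg335Y
  B9Thm31SiteGsqBlockDistReg335Y B6Geom246MultiLevelTorus B6TorusSiteWalks B6AgmonExponentMultiLevelTorus B4TorusKernel.MultiPeriod
open Literature.MathematicalPhysics.QuantumFieldTheory.Balaban1983to89.B9Ineq349SiteAdjoint (trIP_comm trIP_cdS_left)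
open Literature.MathematicalPhysics.QuantumFieldTheory.Balaban1983to89.B9Thm311FlippedBondLetters (hs_real_smul)
open Literature.MathematicalPhysics.QuantumFieldTheory.Balaban1983to89.B9Eq346GradGpDivTorusL2 (msRhoYPos_bond msRhoYPos_bond' msRhoYPos_block msRhoYPos_eq_zero msRhoYPos_eq_zero_shift msRhoYPos_ge msRhoYPos_ge_of_le)
open Literature.MathematicalPhysics.QuantumFieldTheory.Balaban1983to89.B9Thm37CubeCoverCommutators (cutMulY cutMulY_apply KhY KhY_eq_add hTY hTY_apply)
open Literature.MathematicalPhysics.QuantumFieldTheory.Balaban1983to89.B9Thm37CubeCoverCommutatorSizes (side_conditions abs_hTY_shiftY_sub_le avgCoeffY_nonneg)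
open Literature.MathematicalPhysics.QuantumFieldTheory.Balaban1983to89.B9Thm311DeltaPrimeSymm (avgCoeffY_eq_ite avgCoeffY_symm)
open scoped Matrix Matrix.Norms.L2Operator

variable {d ℓ : ℕ} {hd : 1 ≤ d + 1} {hL : Odd (ℓ + 1) ∧ 1 < ℓ + 1} {b₀ b₁ : ℝ}
variable (i : KIdx d ℓ hd hL b₀ b₁) {N : ℕ} {G : Subgroup (Matrix (Fin N) (Fin N) ℂ)ˣ}

section RecordCutoff

/-! ## §R1 The sizes of the partition of record `h_□ = hTY i q` (□ = `q ∈ cubes 𝔅`, level `j = q.1.1`, `S_j = bigSide ℓ M_h j = M_h·L^{j+1}`) in files 22–23's hypothesis shapes -/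


/-- `|h_□| ≤ 1` at the partition of record (`0 ≤ h_□ ≤ 1`). [cite: Balaban1984PropagatorsII, (2.36) p.229; Balaban1985BackgroundPropagators, p.408] -/
theorem abs_hTY_le_one (q : ↥(B6Cover236MultiLevelBlocks.cubes i.D.toDomains)) (z : SiteY i) : |hTY i q z| ≤ 1 := by
  obtain ⟨_, hMh, _, hP5⟩ := side_conditions i
  exact B6Partition118KLevelTorus.abs_hT_le_one (D := i.D) (le_trans (by norm_num) hMh) (fun μ => le_trans (by norm_num) (hP5 μ)) q z

/-- the axis second difference of `h_□`, per direction, in files 22–23's arrangement (`B9Thm37TransposedCommutator.abs_hTY_second_diff_le`, reordered):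
`|h_□(z+e_μ) + h_□(z−e_μ) − 2h_□(z)| ≤ C2F∕(8∕5·S_j)²` (print: `|Δh_□| ≤ O(1)(MLʲη)⁻²`).
[cite: Balaban1984PropagatorsII, p.247 («|Δh_□| ≤ O(1)(MLʲη)⁻²»); Balaban1985BackgroundPropagators, (3.88) p.409] -/
theorem abs_hTY_second_diff_le' (q : ↥(B6Cover236MultiLevelBlocks.cubes i.D.toDomains)) (μ : Fin (d + 1)) (z : SiteY i) :
    |hTY i q (shiftY i μ z) + hTY i q ((shiftY i μ).symm z) - 2 * hTY i q z| ≤ B6Partition118KLevelFineSecond.C2F d ℓ / (8 / 5 * (bigSide ℓ i.Mh q.1.1 : ℝ)) ^ 2 := by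
  have h := B9Thm37TransposedCommutator.abs_hTY_second_diff_le i q μ z
  rwa [show hTY i q (shiftY i μ z) - 2 * hTY i q z + hTY i q ((shiftY i μ).symm z)
      = hTY i q (shiftY i μ z) + hTY i q ((shiftY i μ).symm z) - 2 * hTY i q z from by ring] at h

/-- inside one block of `𝔅` the cut-off `h_□` oscillates by at most `sLipT∕(L·M_h)` (print: «h_□′(x′) − h_□′(x) can be estimated by O(1)M⁻¹d(y,y′)», distance 0).
[cite: Balaban1984PropagatorsII, p.247; Balaban1985BackgroundPropagators, (3.88) p.409 (second line)] -/
theorem abs_hTY_sub_le_of_blkOf_eq (q : ↥(B6Cover236MultiLevelBlocks.cubes i.D.toDomains)) {z w : SiteY i} (hzw : blkOf i.D.toDomains w = blkOf i.D.toDomains z) :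
    |hTY i q z - hTY i q w| ≤ B6Partition118KLevelTorusBinders.sLipT d ℓ / (((ℓ : ℝ) + 1) * i.Mh) := by
  obtain ⟨hℓ, hMh, hR, hP5⟩ := side_conditions i
  have h := B6Partition118KLevelTorusBinders.abs_hT_sub_le_distT (D := i.D) hℓ hMh hR hP5 q w z
  rw [hzw, SimpleGraph.dist_self, Nat.cast_zero, zero_add, mul_one] at h
  exact h


/-! ## §W1 The plain `K(h)`-factor of the walk, `K(h)G′_□M_h`, in `L²` (the middle factors of (3.88)'s resummation) -/


/-- `M_hΛ` vanishes where `Λ` does (companion of NODE 00's `OpsYLeibnizLettersSizes.cutMulY_apply_eq_zero`, which is the case `h z = 0`).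
[cite: Balaban1985BackgroundPropagators, (3.88) p.409, bookkeeping] -/
theorem cutMulY_apply_eq_zero_of_apply_eq_zero {h : SiteY i → ℝ} {Λ : SiteY i → Matrix (Fin N) (Fin N) ℂ} {z : SiteY i} (hz : Λ z = 0) :
    cutMulY h Λ z = 0 := by
  rw [cutMulY_apply, hz, smul_zero]

variable [Nonempty (Fin N)]

/-- ★★★ **THE PLAIN `K(h)`-FACTOR OF THE WALK IN `L²`, UNIFORMLY IN □** — the middle factors `K(h_□)G′_□(U)h_□` of the resummation of (3.88), against an ARBITRARY
source `Λ` carried by `B`: ANY site set `D`, ANY real cut-off (`|h| ≤ 1`, `|∂h| ≤ κ`, `|∂∂h| ≤ κ₂`, block oscillation `≤ κ_b`), a weight `ω` as in files 6∕8 (`= 1` on `B`,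
`≥ W` on the block-saturated output set `A` AND on its backward neighbours), levels in `[j′_A, j_A]` on `A`, `≤ j_B` on `B`:
`Σ_{z∈A} HS((K(h)(U) G′_□(U) M_h Λ)(z)) ≤ [1280(d+1)(d+2)κ²·L^{2j_B} + (1024(d+1)²κ₂² + 512κ_b²L^{−4j′_A})·L^{2j_A}L^{2j_B}]∕W² · ‖Λ‖²₁`
((3.46a)∕(3.46b) for `G′_□`, files 20∕21, fed into file 23's `hs_KhY_apply_le`).
[cite: Balaban1985BackgroundPropagators, (3.88)–(3.89) p.409, Cor 3.6 p.408, (3.46) p.398; Balaban1984PropagatorsII, (2.40)–(2.44) p.230, p.247; Agmon1982, Ch.1, Thm 1.5] -/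
theorem hs_restrict_KhY_GsqY_cutMulY_le (hG : G ≤ B7Prop2Explicit.unitaryUnits (Matrix (Fin N) (Fin N) ℂ))
    {U : CfgY (Matrix (Fin N) (Fin N) ℂ) i} {c α₀ : ℝ} (hC0 : 0 ≤ c * (kGeo i).M * α₀) (hC1 : c * (kGeo i).M * α₀ * ((d : ℝ) + 1) ≤ 1 / 16)
    (hreg : (bg9K (Matrix (Fin N) (Fin N) ℂ) G i).Reg335 c α₀ U) (D : Finset (SiteY i)) {ω : SiteY i → ℝ} (hω : ∀ z, 0 < ω z) {θb θs : ℝ}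
    (hθb0 : 0 ≤ θb) (hθs0 : 0 ≤ θs)
    (hb1 : ∀ μ z, ω (shiftY i μ z) / ω z + ω z / ω (shiftY i μ z) - 2 ≤ θb * (((((ℓ + 1) ^ (blkOf i.D.toDomains z).1.1 : ℕ) : ℝ)) ^ 2)⁻¹)
    (hb2 : ∀ μ z, ω (shiftY i μ z) / ω z + ω z / ω (shiftY i μ z) - 2 ≤ θb * (((((ℓ + 1) ^ (blkOf i.D.toDomains (shiftY i μ z)).1.1 : ℕ) : ℝ)) ^ 2)⁻¹)
    (hs : ∀ z w : SiteY i, blkOf i.D.toDomains w = blkOf i.D.toDomains z → ω z / ω w + ω w / ω z - 2 ≤ θs)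
    (hκ : ((d : ℝ) + 1) * θb + θs / 2 ≤ 1 / 16)
    {h : SiteY i → ℝ} {κ κ₂ κb : ℝ} (hh1 : ∀ z, |h z| ≤ 1) (hhκ : ∀ μ z, |h (shiftY i μ z) - h z| ≤ κ)
    (hhκ₂ : ∀ μ z, |h (shiftY i μ z) + h ((shiftY i μ).symm z) - 2 * h z| ≤ κ₂)
    (hhb : ∀ z w : SiteY i, blkOf i.D.toDomains w = blkOf i.D.toDomains z → |h z - h w| ≤ κb)
    {A B : Finset (SiteY i)} (hAblk : ∀ z ∈ A, ∀ w, blkOf i.D.toDomains w = blkOf i.D.toDomains z → w ∈ A)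
    {Λ : SiteY i → Matrix (Fin N) (Fin N) ℂ} (hΛ : ∀ z, z ∉ B → Λ z = 0) (hωB : ∀ z ∈ B, ω z = 1)
    {jA jA' jB : ℕ} (hjA : ∀ z ∈ A, (blkOf i.D.toDomains z).1.1 ≤ jA) (hjA' : ∀ z ∈ A, jA' ≤ (blkOf i.D.toDomains z).1.1)
    (hjB : ∀ z ∈ B, (blkOf i.D.toDomains z).1.1 ≤ jB)
    {W : ℝ} (hW0 : 0 < W) (hW : ∀ z ∈ A, W ≤ ω z) (hW' : ∀ ν, ∀ z ∈ A, W ≤ ω ((shiftY i ν).symm z)) :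
    ∑ z ∈ A, ∑ a, ∑ b, ‖KhY i (parSymY i) h U (GsqY i (parSymY i) D U (cutMulY h Λ)) z a b‖ ^ 2
      ≤ (1280 * ((d : ℝ) + 1) * ((d : ℝ) + 2) * κ ^ 2 * ((((ℓ + 1) ^ jB : ℕ) : ℝ)) ^ 2
          + (1024 * (((d : ℝ) + 1) * κ₂) ^ 2 + 512 * κb ^ 2 * ((((((ℓ + 1) ^ jA' : ℕ) : ℝ)) ^ 2)⁻¹) ^ 2)
            * (((((ℓ + 1) ^ jA : ℕ) : ℝ)) ^ 2 * ((((ℓ + 1) ^ jB : ℕ) : ℝ)) ^ 2))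
        / W ^ 2 * trIP (fun _ => (1 : ℝ)) Λ Λ := by
  classical
  have hU : ∀ μ x, U μ x ∈ G := hreg.1
  set Φ := GsqY i (parSymY i) D U (cutMulY h Λ) with hΦ
  set Q := trIP (fun _ => (1 : ℝ)) Λ Λ with hQ
  have hQ0 : 0 ≤ Q := trIP_self_nonneg _ (fun _ => one_pos) Λ
  have hQ' : trIP (fun _ => (1 : ℝ)) (cutMulY h Λ) (cutMulY h Λ) ≤ Q := trIP_cutMulY_self_le i hh1 Λ
  have hΛ' : ∀ z, z ∉ B → cutMulY h Λ z = 0 := fun z hz => cutMulY_apply_eq_zero_of_apply_eq_zero i (hΛ z hz)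
  have hW2 : (0 : ℝ) < W ^ 2 := by positivity
  set LB := ((((ℓ + 1) ^ jB : ℕ) : ℝ)) ^ 2 with hLB
  set LA := ((((ℓ + 1) ^ jA : ℕ) : ℝ)) ^ 2 with hLA
  set mA := (((((ℓ + 1) ^ jA' : ℕ) : ℝ)) ^ 2)⁻¹ with hmA
  -- the two □-uniform inputs: (3.46a) (file 20) and (3.46b) (file 21) for `G′_□` against the source `M_hΛ`, `‖M_hΛ‖ ≤ ‖Λ‖`
  have mΦ : ∑ z ∈ A, ∑ a, ∑ b, ‖Φ z a b‖ ^ 2 ≤ 256 * (LA * LB / W ^ 2) * Q :=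
    (hs_restrict_GsqY_parSymY_le i hG hC0 hC1 hreg D hω hb1 hb2 hs hκ hΛ' hωB hjA hjB hW0 hW).trans
      (mul_le_mul_of_nonneg_left hQ' (by positivity))
  have mDω : ∀ {A' : Finset (SiteY i)}, (∀ z ∈ A', W ≤ ω z) →
      ∑ z ∈ A', ∑ ν : Fin (d + 1), ∑ a, ∑ b, ‖cdS i U ν Φ z a b‖ ^ 2 ≤ 160 * (LB / W ^ 2) * Q := fun hWA =>
    (hs_restrict_cdS_GsqY_parSymY_le i hG hC0 hC1 hreg D hω hθb0 hθs0 hb1 hb2 hs hκ hΛ' hωB hjB hW0 hWA).trans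
      (mul_le_mul_of_nonneg_left hQ' (by positivity))
  have mD : ∑ z ∈ A, ∑ ν : Fin (d + 1), ∑ a, ∑ b, ‖cdS i U ν Φ z a b‖ ^ 2 ≤ 160 * (LB / W ^ 2) * Q := mDω hW
  have mD' : ∀ ν : Fin (d + 1), ∑ z ∈ A, ∑ a, ∑ b, ‖cdsS i U ν Φ z a b‖ ^ 2 ≤ 160 * (LB / W ^ 2) * Q := by
    intro ν
    have h1 : ∑ z ∈ A, ∑ a, ∑ b, ‖cdsS i U ν Φ z a b‖ ^ 2 ≤ ∑ z ∈ A.image (shiftY i ν).symm, ∑ a, ∑ b, ‖cdS i U ν Φ z a b‖ ^ 2 := by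
      rw [Finset.sum_image (fun x _ y _ hxy => (shiftY i ν).symm.injective hxy)]
      exact Finset.sum_le_sum fun z _ => hs_cdsS_le_hs_cdS_symm i hG hU ν Φ z
    have hW'' : ∀ z ∈ A.image (shiftY i ν).symm, W ≤ ω z := by
      intro z hz
      obtain ⟨x, hx, rfl⟩ := Finset.mem_image.1 hz
      exact hW' ν x hx
    refine h1.trans (le_trans (Finset.sum_le_sum fun z _ => ?_) (mDω hW''))
    exact Finset.single_le_sum (f := fun ν' : Fin (d + 1) => ∑ a, ∑ b, ‖cdS i U ν' Φ z a b‖ ^ 2) (fun _ _ => hs_nonneg _) (Finset.mem_univ ν)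
  -- the averaging line summed over the block-saturated `A` (file 23's step, verbatim)
  have mAvg : ∑ z ∈ A, ((((((ℓ + 1) ^ (blkOf i.D.toDomains z).1.1 : ℕ) : ℝ)) ^ 2)⁻¹ * ∑ w, avgCoeffY i z w * ∑ a, ∑ b, ‖Φ w a b‖ ^ 2)
      ≤ mA ^ 2 * ∑ w ∈ A, ∑ a, ∑ b, ‖Φ w a b‖ ^ 2 := by
    have hmz : ∀ z ∈ A, (((((ℓ + 1) ^ (blkOf i.D.toDomains z).1.1 : ℕ) : ℝ)) ^ 2)⁻¹ ≤ mA := by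
      intro z hz
      apply inv_anti₀ (by positivity)
      have : (((ℓ + 1) ^ jA' : ℕ) : ℝ) ≤ (((ℓ + 1) ^ (blkOf i.D.toDomains z).1.1 : ℕ) : ℝ) := by
        exact_mod_cast Nat.pow_le_pow_right (Nat.succ_pos ℓ) (hjA' z hz)
      exact pow_le_pow_left₀ (by positivity) this 2
    have hin : ∀ z ∈ A, ∑ w, avgCoeffY i z w * ∑ a, ∑ b, ‖Φ w a b‖ ^ 2 = ∑ w ∈ A, avgCoeffY i z w * ∑ a, ∑ b, ‖Φ w a b‖ ^ 2 := by
      intro z hz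
      rw [← Finset.sum_subset (Finset.subset_univ A)]
      intro w _ hw
      have : blkOf i.D.toDomains w ≠ blkOf i.D.toDomains z := fun hzw => hw (hAblk z hz w hzw)
      rw [avgCoeffY_eq_ite, if_neg this, zero_mul]
    calc ∑ z ∈ A, ((((((ℓ + 1) ^ (blkOf i.D.toDomains z).1.1 : ℕ) : ℝ)) ^ 2)⁻¹ * ∑ w, avgCoeffY i z w * ∑ a, ∑ b, ‖Φ w a b‖ ^ 2)
        ≤ ∑ z ∈ A, (mA * ∑ w ∈ A, avgCoeffY i z w * ∑ a, ∑ b, ‖Φ w a b‖ ^ 2) := by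
          refine Finset.sum_le_sum fun z hz => ?_
          rw [hin z hz]
          exact mul_le_mul_of_nonneg_right (hmz z hz) (Finset.sum_nonneg fun w _ => mul_nonneg (avgCoeffY_nonneg i z w) (hs_nonneg _))
      _ = mA * ∑ w ∈ A, (∑ z ∈ A, avgCoeffY i z w) * ∑ a, ∑ b, ‖Φ w a b‖ ^ 2 := by
          rw [← Finset.mul_sum, Finset.sum_comm]
          congr 1
          exact Finset.sum_congr rfl fun w _ => by rw [Finset.sum_mul]
      _ ≤ mA * ∑ w ∈ A, (mA * ∑ a, ∑ b, ‖Φ w a b‖ ^ 2) := by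
          refine mul_le_mul_of_nonneg_left (Finset.sum_le_sum fun w hw => mul_le_mul_of_nonneg_right ?_ (hs_nonneg _)) (by positivity)
          calc ∑ z ∈ A, avgCoeffY i z w ≤ ∑ z, avgCoeffY i z w :=
                Finset.sum_le_univ_sum_of_nonneg fun z => avgCoeffY_nonneg i z w
            _ = ∑ z, avgCoeffY i w z := Finset.sum_congr rfl fun z _ => avgCoeffY_symm i z w
            _ ≤ _ := (sum_avgCoeffY_le i w).trans (hmz w hw)
      _ = mA ^ 2 * ∑ w ∈ A, ∑ a, ∑ b, ‖Φ w a b‖ ^ 2 := by rw [← Finset.mul_sum]; ring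
  -- sum the pointwise bound over `A`
  have hpt := fun z => hs_KhY_apply_le i hG hU hhκ hhκ₂ hhb Φ z
  refine (Finset.sum_le_sum fun z (_ : z ∈ A) => hpt z).trans ?_
  rw [Finset.sum_add_distrib, Finset.sum_add_distrib, ← Finset.mul_sum, ← Finset.mul_sum]
  have hκb0 : 0 ≤ κb := le_trans (abs_nonneg _) (hhb (Classical.arbitrary _) (Classical.arbitrary _) rfl)
  have g1 : ∑ z ∈ A, ∑ ν : Fin (d + 1), (∑ a, ∑ b, ‖cdS i U ν Φ z a b‖ ^ 2 + ∑ a, ∑ b, ‖cdsS i U ν Φ z a b‖ ^ 2)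
      ≤ ((d : ℝ) + 2) * (160 * (LB / W ^ 2) * Q) := by
    rw [Finset.sum_comm]
    simp only [Finset.sum_add_distrib]
    have hA1 : ∑ ν : Fin (d + 1), ∑ z ∈ A, ∑ a, ∑ b, ‖cdS i U ν Φ z a b‖ ^ 2 ≤ 160 * (LB / W ^ 2) * Q := by
      rw [Finset.sum_comm]; exact mD
    have hA2 : ∑ ν : Fin (d + 1), ∑ z ∈ A, ∑ a, ∑ b, ‖cdsS i U ν Φ z a b‖ ^ 2 ≤ ((d : ℝ) + 1) * (160 * (LB / W ^ 2) * Q) := by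
      calc ∑ ν : Fin (d + 1), ∑ z ∈ A, ∑ a, ∑ b, ‖cdsS i U ν Φ z a b‖ ^ 2 ≤ ∑ _ν : Fin (d + 1), 160 * (LB / W ^ 2) * Q :=
            Finset.sum_le_sum fun ν _ => mD' ν
        _ = _ := by rw [Finset.sum_const, Finset.card_univ, Fintype.card_fin, nsmul_eq_mul]; push_cast; ring
    linarith
  have g3 := mAvg.trans (mul_le_mul_of_nonneg_left mΦ (sq_nonneg _))
  have g3' : ∑ z ∈ A, 2 * κb ^ 2 * (((((ℓ + 1) ^ (blkOf i.D.toDomains z).1.1 : ℕ) : ℝ)) ^ 2)⁻¹ * ∑ w, avgCoeffY i z w * ∑ a, ∑ b, ‖Φ w a b‖ ^ 2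
      ≤ 2 * κb ^ 2 * (mA ^ 2 * (256 * (LA * LB / W ^ 2) * Q)) := by
    have e : ∑ z ∈ A, 2 * κb ^ 2 * (((((ℓ + 1) ^ (blkOf i.D.toDomains z).1.1 : ℕ) : ℝ)) ^ 2)⁻¹ * ∑ w, avgCoeffY i z w * ∑ a, ∑ b, ‖Φ w a b‖ ^ 2
        = 2 * κb ^ 2 * ∑ z ∈ A, ((((((ℓ + 1) ^ (blkOf i.D.toDomains z).1.1 : ℕ) : ℝ)) ^ 2)⁻¹ * ∑ w, avgCoeffY i z w * ∑ a, ∑ b, ‖Φ w a b‖ ^ 2) := by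
      rw [Finset.mul_sum]
      exact Finset.sum_congr rfl fun z _ => by ring
    rw [e]
    exact mul_le_mul_of_nonneg_left g3 (by positivity)
  have etot : (1280 * ((d : ℝ) + 1) * ((d : ℝ) + 2) * κ ^ 2 * LB + (1024 * (((d : ℝ) + 1) * κ₂) ^ 2 + 512 * κb ^ 2 * mA ^ 2) * (LA * LB)) / W ^ 2 * Q
      = 8 * ((d : ℝ) + 1) * κ ^ 2 * (((d : ℝ) + 2) * (160 * (LB / W ^ 2) * Q))
        + 4 * (((d : ℝ) + 1) * κ₂) ^ 2 * (256 * (LA * LB / W ^ 2) * Q)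
        + 2 * κb ^ 2 * (mA ^ 2 * (256 * (LA * LB / W ^ 2) * Q)) := by
    field_simp
    ring
  rw [etot]
  exact add_le_add (add_le_add (mul_le_mul_of_nonneg_left g1 (by positivity)) (mul_le_mul_of_nonneg_left mΦ (by positivity))) g3'

/-! ## §W0 The first factor `h G′_□ M_h` of the walk (it is (3.46a) for `G′_□`, file 20, with `|h| ≤ 1` on both sides) -/

omit [Nonempty (Fin N)] in
/-- pointwise, `HS((M_hΛ)(z)) ≤ HS(Λ z)` for a real cut-off with `|h| ≤ 1`. [cite: Balaban1985BackgroundPropagators, (3.88) p.409, bookkeeping] -/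
theorem hs_cutMulY_apply_le {h : SiteY i → ℝ} (hh1 : ∀ z, |h z| ≤ 1) (Λ : SiteY i → Matrix (Fin N) (Fin N) ℂ) (z : SiteY i) :
    ∑ a, ∑ b, ‖cutMulY h Λ z a b‖ ^ 2 ≤ ∑ a, ∑ b, ‖Λ z a b‖ ^ 2 := by
  have e : cutMulY (𝔸 := Matrix (Fin N) (Fin N) ℂ) h Λ z = ((h z : ℝ) : ℂ) • Λ z := cutMulY_apply h Λ z
  rw [e, hs_real_smul]
  have hh2 : h z ^ 2 ≤ 1 := by have := hh1 z; rw [← sq_abs]; nlinarith [abs_nonneg (h z)]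
  have hB := hs_nonneg (Λ z)
  nlinarith

/-- ★★ **THE FIRST FACTOR OF THE WALK, `M_h G′_□ M_h`, FROM BLOCK `s` TO BLOCKS AT DISTANCE `≥ n`** ((3.46a) for `G′_□`, file 20's `hs_restrict_GsqY_parSymY_le_distT`, between
two cut-offs `|h| ≤ 1`): `Σ_{z∈A} HS((M_h G′ M_h Λ)(z)) ≤ 256·L^{2j_A}L^{2j_s}·e^{−2δ₀(n−1)∕(2L)}·‖Λ‖²₁`.
[cite: Balaban1985BackgroundPropagators, (3.88) p.409, Cor 3.6 p.408, (3.46) p.398; Balaban1984PropagatorsII, (2.43) p.230, (2.46) p.231; Agmon1982, Ch.1, Thm 1.5] -/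
theorem hs_restrict_cutMulY_GsqY_cutMulY_le_distT (hG : G ≤ B7Prop2Explicit.unitaryUnits (Matrix (Fin N) (Fin N) ℂ))
    {U : CfgY (Matrix (Fin N) (Fin N) ℂ) i} {c α₀ : ℝ} (hC0 : 0 ≤ c * (kGeo i).M * α₀) (hC1 : c * (kGeo i).M * α₀ * ((d : ℝ) + 1) ≤ 1 / 16)
    (hreg : (bg9K (Matrix (Fin N) (Fin N) ℂ) G i).Reg335 c α₀ U) (D : Finset (SiteY i))
    {h : SiteY i → ℝ} (hh1 : ∀ z, |h z| ≤ 1) (s : BlkY i)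
    {A : Finset (SiteY i)} {Λ : SiteY i → Matrix (Fin N) (Fin N) ℂ} (hΛ : ∀ z, blkOf i.D.toDomains z ≠ s → Λ z = 0)
    {n : ℕ} (hA : ∀ z ∈ A, n ≤ (bondT i.D).dist (blkOf i.D.toDomains z) s) {jA : ℕ} (hjA : ∀ z ∈ A, (blkOf i.D.toDomains z).1.1 ≤ jA) :
    ∑ z ∈ A, ∑ a, ∑ b, ‖cutMulY h (GsqY i (parSymY i) D U (cutMulY h Λ)) z a b‖ ^ 2
      ≤ 256 * (((((ℓ + 1) ^ jA : ℕ) : ℝ)) ^ 2 * ((((ℓ + 1) ^ s.1.1 : ℕ) : ℝ)) ^ 2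
            / Real.exp ((1 / (4 * ((d : ℝ) + 2))) * ((((n : ℝ)) - 1) / (2 * ((ℓ + 1 : ℕ) : ℝ)))) ^ 2)
          * trIP (fun _ => (1 : ℝ)) Λ Λ := by
  classical
  set B : Finset (SiteY i) := Finset.univ.filter (fun z => blkOf i.D.toDomains z = s) with hBdef
  have hBmem : ∀ z, z ∈ B ↔ blkOf i.D.toDomains z = s := fun z => by simp [hBdef]
  have hΨ : ∀ z, z ∉ B → cutMulY h Λ z = 0 := fun z hz =>
    cutMulY_apply_eq_zero_of_apply_eq_zero i (hΛ z (fun e => hz ((hBmem z).2 e)))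
  have hB : ∀ z ∈ B, blkOf i.D.toDomains z = s := fun z hz => (hBmem z).1 hz
  have hjB : ∀ z ∈ B, (blkOf i.D.toDomains z).1.1 ≤ s.1.1 := fun z hz => by rw [(hBmem z).1 hz]
  have h1 := hs_restrict_GsqY_parSymY_le_distT i hG hC0 hC1 hreg D s hΨ hB hA hjA hjB
  refine (Finset.sum_le_sum fun z _ => hs_cutMulY_apply_le i hh1 _ z).trans (h1.trans ?_)
  exact mul_le_mul_of_nonneg_left (trIP_cutMulY_self_le i hh1 Λ) (by positivity)

/-! ## §W2 The plain `K(h)`-factor block to block with print's rate -/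

/-- ★★★ **THE PLAIN `K(h)`-FACTOR FROM BLOCK `s` TO BLOCK `t`**, `d_T(t,s) ≥ n` (print's (3.89) in `L²` for the middle factors; weight = dag-n06-w7's `ρ⁺_s` as in file 24):
`Σ_{z∈t} HS((K(h)(U) G′_□ M_h Λ)(z)) ≤ [1280(d+1)(d+2)κ²L^{2(j_s+1)} + (1024(d+1)²κ₂² + 512κ_b²L^{−4j_t})L^{2j_t}L^{2(j_s+1)}]·e^{−2δ₀((n−2)∕(2L) − 1)}·‖Λ‖²₁`.
[cite: Balaban1985BackgroundPropagators, (3.88)–(3.89) p.409, Cor 3.6 p.408, (3.46) p.398; Balaban1984PropagatorsII, (2.40)–(2.44) p.230, (2.46) p.231, p.247; Agmon1982, Ch.1, Thm 1.5] -/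
theorem hs_block_KhY_GsqY_cutMulY_le_distT (hG : G ≤ B7Prop2Explicit.unitaryUnits (Matrix (Fin N) (Fin N) ℂ))
    {U : CfgY (Matrix (Fin N) (Fin N) ℂ) i} {c α₀ : ℝ} (hC0 : 0 ≤ c * (kGeo i).M * α₀) (hC1 : c * (kGeo i).M * α₀ * ((d : ℝ) + 1) ≤ 1 / 16)
    (hreg : (bg9K (Matrix (Fin N) (Fin N) ℂ) G i).Reg335 c α₀ U) (D : Finset (SiteY i))
    {h : SiteY i → ℝ} {κ κ₂ κb : ℝ} (hh1 : ∀ z, |h z| ≤ 1) (hhκ : ∀ μ z, |h (shiftY i μ z) - h z| ≤ κ)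
    (hhκ₂ : ∀ μ z, |h (shiftY i μ z) + h ((shiftY i μ).symm z) - 2 * h z| ≤ κ₂)
    (hhb : ∀ z w : SiteY i, blkOf i.D.toDomains w = blkOf i.D.toDomains z → |h z - h w| ≤ κb) (s t : BlkY i)
    {Λ : SiteY i → Matrix (Fin N) (Fin N) ℂ} (hΛ : ∀ z, blkOf i.D.toDomains z ≠ s → Λ z = 0) {n : ℕ} (hn : n ≤ (bondT i.D).dist t s) :
    ∑ z ∈ Finset.univ.filter (fun z => blkOf i.D.toDomains z = t), ∑ a, ∑ b, ‖KhY i (parSymY i) h U (GsqY i (parSymY i) D U (cutMulY h Λ)) z a b‖ ^ 2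
      ≤ (1280 * ((d : ℝ) + 1) * ((d : ℝ) + 2) * κ ^ 2 * ((((ℓ + 1) ^ (s.1.1 + 1) : ℕ) : ℝ)) ^ 2
          + (1024 * (((d : ℝ) + 1) * κ₂) ^ 2 + 512 * κb ^ 2 * ((((((ℓ + 1) ^ t.1.1 : ℕ) : ℝ)) ^ 2)⁻¹) ^ 2)
            * (((((ℓ + 1) ^ t.1.1 : ℕ) : ℝ)) ^ 2 * ((((ℓ + 1) ^ (s.1.1 + 1) : ℕ) : ℝ)) ^ 2))
        / Real.exp ((1 / (4 * ((d : ℝ) + 2))) * (((((n : ℝ)) - 2) / (2 * ((ℓ + 1 : ℕ) : ℝ)) - 1))) ^ 2 * trIP (fun _ => (1 : ℝ)) Λ Λ := by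
  classical
  -- the source block read as the `μ := 0` source set of file 24 (`Δ(s) ⊆ Δ(s) ∪ (Δ(s)+e_0)`)
  obtain ⟨hΛB, -, hρB, hjB⟩ := srcSet_facts i (0 : Fin (d + 1)) s hΛ
  set A : Finset (SiteY i) := Finset.univ.filter (fun z => blkOf i.D.toDomains z = t) with hAdef
  have hAmem : ∀ z, z ∈ A ↔ blkOf i.D.toDomains z = t := fun z => by simp [hAdef]
  have hd0 : (0 : ℝ) ≤ d := Nat.cast_nonneg d
  have hd2 : (0 : ℝ) < 4 * ((d : ℝ) + 2) := by positivity
  have hδ0 : (0 : ℝ) ≤ 1 / (4 * ((d : ℝ) + 2)) := by positivity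
  have hδ1 : 1 / (4 * ((d : ℝ) + 2)) ≤ 1 := by rw [div_le_one hd2]; linarith
  have hδD : 1 / (4 * ((d : ℝ) + 2)) * ((d : ℝ) + 1) ≤ 1 := by rw [div_mul_eq_mul_div, one_mul, div_le_one hd2]; linarith
  have hδκ0 : (1 / (4 * ((d : ℝ) + 2))) ^ 2 * (2 * ((d : ℝ) + 1) + ((d : ℝ) + 1) ^ 2) ≤ 1 / 16 := by
    rw [div_pow, one_pow, mul_pow, one_div_mul_eq_div, div_le_iff₀ (by positivity)]; nlinarith
  have hδκ : ((d : ℝ) + 1) * (2 * (1 / (4 * ((d : ℝ) + 2))) ^ 2) + (2 * (1 / (4 * ((d : ℝ) + 2))) ^ 2 * ((d : ℝ) + 1) ^ 2) / 2 ≤ 1 / 16 := by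
    have e : ((d : ℝ) + 1) * (2 * (1 / (4 * ((d : ℝ) + 2))) ^ 2) + (2 * (1 / (4 * ((d : ℝ) + 2))) ^ 2 * ((d : ℝ) + 1) ^ 2) / 2
        = (1 / (4 * ((d : ℝ) + 2))) ^ 2 * (2 * ((d : ℝ) + 1) + ((d : ℝ) + 1) ^ 2) := by ring
    rw [e]; exact hδκ0
  set ρ : SiteY i → ℝ := fun z => max (msRhoT i.D s z - 1) 0 with hρ
  have hω : ∀ z, 0 < Real.exp (1 / (4 * ((d : ℝ) + 2)) * ρ z) := fun z => Real.exp_pos _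
  have hωB : ∀ z ∈ Finset.univ.filter (fun z => blkOf i.D.toDomains z = s ∨ blkOf i.D.toDomains ((shiftY i (0 : Fin (d + 1))).symm z) = s),
      Real.exp (1 / (4 * ((d : ℝ) + 2)) * ρ z) = 1 := fun z hz => by rw [hρ]; simp only []; rw [hρB z hz, mul_zero, Real.exp_zero]
  set r : ℝ := ((((n : ℝ)) - 2) / (2 * ((ℓ + 1 : ℕ) : ℝ)) - 1) with hr
  have hLpos : (0 : ℝ) < 2 * ((ℓ + 1 : ℕ) : ℝ) := by positivity
  have hfloor : ∀ w : SiteY i, n - 1 ≤ (bondT i.D).dist (blkOf i.D.toDomains w) s → r ≤ ρ w := by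
    intro w hw
    refine le_trans ?_ (msRhoYPos_ge i s w)
    have h1 : ((n : ℝ)) - 2 ≤ ((bondT i.D).dist (blkOf i.D.toDomains w) s : ℝ) - 1 := by
      have h2 : ((n - 1 : ℕ) : ℝ) ≤ ((bondT i.D).dist (blkOf i.D.toDomains w) s : ℝ) := by exact_mod_cast hw
      have h3 : ((n : ℝ)) - 1 ≤ ((n - 1 : ℕ) : ℝ) := by
        rcases Nat.eq_zero_or_pos n with h0 | hpos
        · simp [h0]
        · rw [Nat.cast_sub hpos]; simp
      linarith
    exact sub_le_sub_right (div_le_div_of_nonneg_right h1 hLpos.le) 1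
  have hW : ∀ z ∈ A, Real.exp (1 / (4 * ((d : ℝ) + 2)) * r) ≤ Real.exp (1 / (4 * ((d : ℝ) + 2)) * ρ z) := by
    intro z hz
    refine Real.exp_le_exp.2 (mul_le_mul_of_nonneg_left (hfloor z ?_) hδ0)
    rw [(hAmem z).1 hz]; omega
  have hW' : ∀ ν, ∀ z ∈ A, Real.exp (1 / (4 * ((d : ℝ) + 2)) * r) ≤ Real.exp (1 / (4 * ((d : ℝ) + 2)) * ρ ((shiftY i ν).symm z)) := by
    intro ν z hz
    refine Real.exp_le_exp.2 (mul_le_mul_of_nonneg_left (hfloor _ ?_) hδ0)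
    exact distT_shiftY_symm_ge i s ν z (n := n) (by rw [(hAmem z).1 hz]; exact hn)
  have hAblk : ∀ z ∈ A, ∀ w, blkOf i.D.toDomains w = blkOf i.D.toDomains z → w ∈ A := fun z hz w hw =>
    (hAmem w).2 (hw.trans ((hAmem z).1 hz))
  have hjA : ∀ z ∈ A, (blkOf i.D.toDomains z).1.1 ≤ t.1.1 := fun z hz => by rw [(hAmem z).1 hz]
  have hjA' : ∀ z ∈ A, t.1.1 ≤ (blkOf i.D.toDomains z).1.1 := fun z hz => by rw [(hAmem z).1 hz]
  exact hs_restrict_KhY_GsqY_cutMulY_le i hG hC0 hC1 hreg D hω (by positivity) (by positivity)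
    (fun μ' z => bondRatio_exp_le i hδ0 hδ1 μ' z (msRhoYPos_bond i s μ' z)) (fun μ' z => bondRatio_exp_le' i hδ0 hδ1 μ' z (msRhoYPos_bond' i s μ' z))
    (fun z w hzw => blockOsc_exp_le i hδ0 hδD z w (msRhoYPos_block i s z w hzw)) hδκ hh1 hhκ hhκ₂ hhb hAblk hΛB hωB hjA hjA' hjB
    (Real.exp_pos _) hW hW'

/-! ## §R2 The factors at the partition of record, block to block: sandwiched mixed member, `K(h_□)`-factor against `∇*_μ`, plain `K(h_□)`-factor, first factor -/

/-- ★★ **THE SANDWICHED MIXED MEMBER `∇_ν h_□ G′ h_□ ∇*_μ` AT THE PARTITION OF RECORD** (dag-n06-k's `L2MixedLegs37.lm`), source on block `s`, output set `A` at distance `≥ n`: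
`Σ_{z∈A} HS((∇_ν h_□ G′ h_□ ∇*_μ λ)(z)) ≤ 4·(10 + κ_j²(16L^{2j_A} + 160L^{2(j_s+1)}) + 256κ_j⁴L^{2j_A}L^{2(j_s+1)})·e^{−2δ₀((n−1)∕(2L) − 1)}·‖λ‖²₁`, `κ_j = C1F∕(8∕5·S_j)`.
[cite: Balaban1985BackgroundPropagators, Cor 3.6 p.408, (3.46) p.398, (3.88)–(3.89) p.409; Balaban1984PropagatorsII, (2.40)–(2.44) p.230, p.247; Agmon1982, Ch.1, Thm 1.5] -/
theorem hs_restrict_cdS_hTY_GsqY_hTY_cdsS_le_distT (hG : G ≤ B7Prop2Explicit.unitaryUnits (Matrix (Fin N) (Fin N) ℂ))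
    {U : CfgY (Matrix (Fin N) (Fin N) ℂ) i} {c α₀ : ℝ} (hC0 : 0 ≤ c * (kGeo i).M * α₀) (hC1 : c * (kGeo i).M * α₀ * ((d : ℝ) + 1) ≤ 1 / 16)
    (hreg : (bg9K (Matrix (Fin N) (Fin N) ℂ) G i).Reg335 c α₀ U) (D : Finset (SiteY i)) (q : ↥(B6Cover236MultiLevelBlocks.cubes i.D.toDomains)) (ν μ : Fin (d + 1)) (s : BlkY i)
    {A : Finset (SiteY i)} {Λ : SiteY i → Matrix (Fin N) (Fin N) ℂ} (hΛ : ∀ z, blkOf i.D.toDomains z ≠ s → Λ z = 0)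
    {n : ℕ} (hA : ∀ z ∈ A, n ≤ (bondT i.D).dist (blkOf i.D.toDomains z) s) {jA : ℕ} (hjA : ∀ z ∈ A, (blkOf i.D.toDomains z).1.1 ≤ jA) :
    ∑ z ∈ A, ∑ a, ∑ b, ‖cdS i U ν (cutMulY (hTY i q) (GsqY i (parSymY i) D U (cutMulY (hTY i q) (cdsS i U μ Λ)))) z a b‖ ^ 2
      ≤ 4 * (10 + (B6Partition118KLevelFineSizes.C1F d ℓ / (8 / 5 * (bigSide ℓ i.Mh q.1.1 : ℝ))) ^ 2 * (16 * ((((ℓ + 1) ^ jA : ℕ) : ℝ)) ^ 2 + 160 * ((((ℓ + 1) ^ (s.1.1 + 1) : ℕ) : ℝ)) ^ 2)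
          + 256 * (B6Partition118KLevelFineSizes.C1F d ℓ / (8 / 5 * (bigSide ℓ i.Mh q.1.1 : ℝ))) ^ 4 * (((((ℓ + 1) ^ jA : ℕ) : ℝ)) ^ 2 * ((((ℓ + 1) ^ (s.1.1 + 1) : ℕ) : ℝ)) ^ 2))
        / Real.exp ((1 / (4 * ((d : ℝ) + 2))) * (((((n : ℝ)) - 1) / (2 * ((ℓ + 1 : ℕ) : ℝ)) - 1))) ^ 2 * trIP (fun _ => (1 : ℝ)) Λ Λ :=
  hs_restrict_cdS_cutMulY_GsqY_cutMulY_cdsS_le_distT i hG hC0 hC1 hreg D (abs_hTY_le_one i q) (abs_hTY_shiftY_sub_le i q) ν μ s hΛ hA hjA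

/-- ★★★ **THE `K(h_□)`-FACTOR `K(h_□)G′h_□∇*_μ` AT THE PARTITION OF RECORD, BLOCK `s` TO BLOCK `t`** (print's (3.89) in `L²`; dag-n06-k's `FactorsL2Mixed37.facDs`):
`Σ_{z∈t} HS(…) ≤ [16(d+1)(d+2)κ_j²(10 + 160κ_j²L^{2(j_s+1)}) + (8(d+1)²κ₂_j² + 4κ_b²L^{−4j_t})(16 + 256κ_j²L^{2(j_s+1)})L^{2j_t}]·e^{−2δ₀((n−2)∕(2L) − 1)}·‖λ‖²₁`
(sizes of [4] p. 247). [cite: Balaban1985BackgroundPropagators, (3.88)–(3.89) p.409, Cor 3.6 p.408, (3.46) p.398; Balaban1984PropagatorsII, (2.40)–(2.44) p.230, p.247; Agmon1982, Ch.1, Thm 1.5] -/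
theorem hs_block_KhTY_GsqY_hTY_cdsS_le_distT (hG : G ≤ B7Prop2Explicit.unitaryUnits (Matrix (Fin N) (Fin N) ℂ))
    {U : CfgY (Matrix (Fin N) (Fin N) ℂ) i} {c α₀ : ℝ} (hC0 : 0 ≤ c * (kGeo i).M * α₀) (hC1 : c * (kGeo i).M * α₀ * ((d : ℝ) + 1) ≤ 1 / 16)
    (hreg : (bg9K (Matrix (Fin N) (Fin N) ℂ) G i).Reg335 c α₀ U) (D : Finset (SiteY i)) (q : ↥(B6Cover236MultiLevelBlocks.cubes i.D.toDomains)) (μ : Fin (d + 1)) (s t : BlkY i)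
    {Λ : SiteY i → Matrix (Fin N) (Fin N) ℂ} (hΛ : ∀ z, blkOf i.D.toDomains z ≠ s → Λ z = 0) {n : ℕ} (hn : n ≤ (bondT i.D).dist t s) :
    ∑ z ∈ Finset.univ.filter (fun z => blkOf i.D.toDomains z = t), ∑ a, ∑ b,
        ‖KhY i (parSymY i) (hTY i q) U (GsqY i (parSymY i) D U (cutMulY (hTY i q) (cdsS i U μ Λ))) z a b‖ ^ 2
      ≤ (16 * ((d : ℝ) + 1) * ((d : ℝ) + 2) * (B6Partition118KLevelFineSizes.C1F d ℓ / (8 / 5 * (bigSide ℓ i.Mh q.1.1 : ℝ))) ^ 2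
            * (10 + 160 * (B6Partition118KLevelFineSizes.C1F d ℓ / (8 / 5 * (bigSide ℓ i.Mh q.1.1 : ℝ))) ^ 2 * ((((ℓ + 1) ^ (s.1.1 + 1) : ℕ) : ℝ)) ^ 2)
          + (8 * (((d : ℝ) + 1) * (B6Partition118KLevelFineSecond.C2F d ℓ / (8 / 5 * (bigSide ℓ i.Mh q.1.1 : ℝ)) ^ 2)) ^ 2
              + 4 * (B6Partition118KLevelTorusBinders.sLipT d ℓ / (((ℓ : ℝ) + 1) * i.Mh)) ^ 2 * ((((((ℓ + 1) ^ t.1.1 : ℕ) : ℝ)) ^ 2)⁻¹) ^ 2)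
            * ((16 + 256 * (B6Partition118KLevelFineSizes.C1F d ℓ / (8 / 5 * (bigSide ℓ i.Mh q.1.1 : ℝ))) ^ 2 * ((((ℓ + 1) ^ (s.1.1 + 1) : ℕ) : ℝ)) ^ 2) * ((((ℓ + 1) ^ t.1.1 : ℕ) : ℝ)) ^ 2))
        / Real.exp ((1 / (4 * ((d : ℝ) + 2))) * (((((n : ℝ)) - 2) / (2 * ((ℓ + 1 : ℕ) : ℝ)) - 1))) ^ 2 * trIP (fun _ => (1 : ℝ)) Λ Λ :=
  hs_block_KhY_GsqY_cutMulY_cdsS_le_distT i hG hC0 hC1 hreg D (abs_hTY_le_one i q) (abs_hTY_shiftY_sub_le i q) (abs_hTY_second_diff_le' i q)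
    (fun _ _ hzw => abs_hTY_sub_le_of_blkOf_eq i q hzw) μ s t hΛ hn

/-- ★★★ **THE PLAIN `K(h_□)`-FACTOR AT THE PARTITION OF RECORD, BLOCK TO BLOCK**: `h = hTY i q` with [4] p. 247's sizes `κ_j = C1F∕(8∕5·S_j)`,
`κ₂_j = C2F∕(8∕5·S_j)²`, `κ_b = sLipT∕(L·M_h)` substituted (no cut-off hypothesis left).
[cite: Balaban1985BackgroundPropagators, (3.88)–(3.89) p.409, Cor 3.6 p.408; Balaban1984PropagatorsII, (2.40)–(2.44) p.230, p.247; Agmon1982, Ch.1, Thm 1.5] -/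
theorem hs_block_KhTY_GsqY_hTY_le_distT (hG : G ≤ B7Prop2Explicit.unitaryUnits (Matrix (Fin N) (Fin N) ℂ))
    {U : CfgY (Matrix (Fin N) (Fin N) ℂ) i} {c α₀ : ℝ} (hC0 : 0 ≤ c * (kGeo i).M * α₀) (hC1 : c * (kGeo i).M * α₀ * ((d : ℝ) + 1) ≤ 1 / 16)
    (hreg : (bg9K (Matrix (Fin N) (Fin N) ℂ) G i).Reg335 c α₀ U) (D : Finset (SiteY i)) (q : ↥(B6Cover236MultiLevelBlocks.cubes i.D.toDomains)) (s t : BlkY i)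
    {Λ : SiteY i → Matrix (Fin N) (Fin N) ℂ} (hΛ : ∀ z, blkOf i.D.toDomains z ≠ s → Λ z = 0) {n : ℕ} (hn : n ≤ (bondT i.D).dist t s) :
    ∑ z ∈ Finset.univ.filter (fun z => blkOf i.D.toDomains z = t), ∑ a, ∑ b,
        ‖KhY i (parSymY i) (hTY i q) U (GsqY i (parSymY i) D U (cutMulY (hTY i q) Λ)) z a b‖ ^ 2
      ≤ (1280 * ((d : ℝ) + 1) * ((d : ℝ) + 2) * (B6Partition118KLevelFineSizes.C1F d ℓ / (8 / 5 * (bigSide ℓ i.Mh q.1.1 : ℝ))) ^ 2 * ((((ℓ + 1) ^ (s.1.1 + 1) : ℕ) : ℝ)) ^ 2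
          + (1024 * (((d : ℝ) + 1) * (B6Partition118KLevelFineSecond.C2F d ℓ / (8 / 5 * (bigSide ℓ i.Mh q.1.1 : ℝ)) ^ 2)) ^ 2
              + 512 * (B6Partition118KLevelTorusBinders.sLipT d ℓ / (((ℓ : ℝ) + 1) * i.Mh)) ^ 2 * ((((((ℓ + 1) ^ t.1.1 : ℕ) : ℝ)) ^ 2)⁻¹) ^ 2)
            * (((((ℓ + 1) ^ t.1.1 : ℕ) : ℝ)) ^ 2 * ((((ℓ + 1) ^ (s.1.1 + 1) : ℕ) : ℝ)) ^ 2))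
        / Real.exp ((1 / (4 * ((d : ℝ) + 2))) * (((((n : ℝ)) - 2) / (2 * ((ℓ + 1 : ℕ) : ℝ)) - 1))) ^ 2 * trIP (fun _ => (1 : ℝ)) Λ Λ :=
  hs_block_KhY_GsqY_cutMulY_le_distT i hG hC0 hC1 hreg D (abs_hTY_le_one i q) (abs_hTY_shiftY_sub_le i q) (abs_hTY_second_diff_le' i q)
    (fun _ _ hzw => abs_hTY_sub_le_of_blkOf_eq i q hzw) s t hΛ hn


/-- ★★ **THE FIRST FACTOR AT THE PARTITION OF RECORD**: `h_□ G′ h_□` from block `s` to blocks at distance `≥ n` (`|h_□| ≤ 1` discharged).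
[cite: Balaban1985BackgroundPropagators, (3.88) p.409, Cor 3.6 p.408, (3.46) p.398; Balaban1984PropagatorsII, (2.36) p.229, (2.43) p.230; Agmon1982, Ch.1, Thm 1.5] -/
theorem hs_restrict_hTY_GsqY_hTY_le_distT (hG : G ≤ B7Prop2Explicit.unitaryUnits (Matrix (Fin N) (Fin N) ℂ))
    {U : CfgY (Matrix (Fin N) (Fin N) ℂ) i} {c α₀ : ℝ} (hC0 : 0 ≤ c * (kGeo i).M * α₀) (hC1 : c * (kGeo i).M * α₀ * ((d : ℝ) + 1) ≤ 1 / 16)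
    (hreg : (bg9K (Matrix (Fin N) (Fin N) ℂ) G i).Reg335 c α₀ U) (D : Finset (SiteY i)) (q : ↥(B6Cover236MultiLevelBlocks.cubes i.D.toDomains)) (s : BlkY i)
    {A : Finset (SiteY i)} {Λ : SiteY i → Matrix (Fin N) (Fin N) ℂ} (hΛ : ∀ z, blkOf i.D.toDomains z ≠ s → Λ z = 0)
    {n : ℕ} (hA : ∀ z ∈ A, n ≤ (bondT i.D).dist (blkOf i.D.toDomains z) s) {jA : ℕ} (hjA : ∀ z ∈ A, (blkOf i.D.toDomains z).1.1 ≤ jA) :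
    ∑ z ∈ A, ∑ a, ∑ b, ‖cutMulY (hTY i q) (GsqY i (parSymY i) D U (cutMulY (hTY i q) Λ)) z a b‖ ^ 2
      ≤ 256 * (((((ℓ + 1) ^ jA : ℕ) : ℝ)) ^ 2 * ((((ℓ + 1) ^ s.1.1 : ℕ) : ℝ)) ^ 2
            / Real.exp ((1 / (4 * ((d : ℝ) + 2))) * ((((n : ℝ)) - 1) / (2 * ((ℓ + 1 : ℕ) : ℝ)))) ^ 2)
          * trIP (fun _ => (1 : ℝ)) Λ Λ :=
  hs_restrict_cutMulY_GsqY_cutMulY_le_distT i hG hC0 hC1 hreg D (abs_hTY_le_one i q) s hΛ hA hjA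

end RecordCutoff

end Literature.MathematicalPhysics.QuantumFieldTheory.Balaban1983to89.B9Thm31SiteGsqRecordCutoffReg335Y
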